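import Summits.BirchSwinnertonDyer.BirchSwinnertonDyer.Theorems.Rank2Observatory2DescClRealCertE2
import Summits.BirchSwinnertonDyer.BirchSwinnertonDyer.Theorems.Rank2Observatory2DescClKillCurveCertE2Defs
import HarnessLib

/-!
# BirchSwinnertonDyer — rank ≥ 2 observatory: KERNEL-2DESC-CL v2.7 — TWO-VIEW certificates WITH A KILL LIST (totally real case), part 1/3: the checker

HONEST FRAMING: per-curve certified theorems and census instruments; no claim on BSD in rank ≥ 2.

The totally real signature of `…ClKillCurveCertE2Defs`: the v2.3 totally real two-view per-curve checker `checkE2R`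
(`…ClRealCertE2Defs`, three-place archimedean sieve `admR2`) with cert-3's LANDED kill list grafted on exactly as in the
complex case — the kill records `ClKillE2`, their light clauses and residue searches `killSearchE2` are those of the complex
file, read on the underlying complex-format records `G.toE2 : ClFieldCertE2`, `ccr.cc : ClCurveCertE2` (the kill quadrics
live in `ℤ[α]` and do not see the real places).  `admR2K G ccr ks` = `admR2 G ccr` minus the killed classes;
`checkE2RK G ccr r ks` = the clauses of `checkE2R G ccr r` except its count, verbatim, the light kill clauses, and
FEWER THAN `2^(r+1)` survivors of `admR2K`.  Soundness is part 2 (`…ClRealKillCertE2`), row shapes part 3.  New declarations only.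
[cite: Cassels1991LecturesEllipticCurves, §15] [cite: CremonaAlgorithms1997, §3.6] [cite: Cohen1993, §4.8.2, §6.2, §6.5]
[cite: Marcus2018, Ch. 5, Thm. 38] [cite: SilvermanAEC2009, X.1.1]
-/

set_option linter.dupNamespace false

noncomputable section

open Polynomial NumberField IsDedekindDomain Module
open Literature.NumberTheory.NumberFields   -- OPENFIX (cert-1 gen 35): `MonicCubic.*` lives in this namespace; the line was missing (inlined-head prechecks leaked it from `…ClRealCertE`)

namespace Summit.BirchSwinnertonDyer.BirchSwinnertonDyer.Rank2Observatory.TwoDescCl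

open TwoDescCubic ClFieldCert

section Checkers

variable (G : ClFieldCertRE2) (ccr : ClCurveCertE2R)

/-- The sieve of a v2.7 totally real row: `admR2 G ccr` minus the killed classes. [folklore] -/
def admR2K (ks : List ClKillE2) : Finset (Fin 0) → Finset (Fin (fam2 ccr.cc).length) → Bool :=
  admKills (admR2 G ccr) (killEntriesE2 G.toE2 ccr.cc ks)

/-- **The totally real two-view per-curve `r`-checker with a kill list**: the clauses of `checkE2R G ccr r` except its
count, verbatim; the light kill clauses (on `G.toE2`, `ccr.cc`); FEWER THAN `2^(r+1)` classes pass `admR2K`.  Computable;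
run by `decide +kernel`. [cite: Cassels1991LecturesEllipticCurves, §15] [cite: CremonaAlgorithms1997, §3.6] -/
def checkE2RK (r : ℕ) (ks : List ClKillE2) : Bool :=
  decide (deltaShort ccr.cc.A ccr.cc.B ccr.cc.C ≠ 0) &&
    noRootMod ccr.cc.pF ccr.cc.A ccr.cc.B ccr.cc.C &&
    decide (cubicAtCoords G.toE2.fe.base.a G.toE2.fe.base.b G.toE2.fe.base.c ((G.toE2.m₁ : ℤ) * ccr.cc.A)
      ((G.toE2.m₁ : ℤ) ^ 2 * ccr.cc.B) ((G.toE2.m₁ : ℤ) ^ 3 * ccr.cc.C) ccr.cc.Xt = (0, 0, 0)) &&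
    decide (derivAtCoords G.toE2.fe.base.a G.toE2.fe.base.b G.toE2.fe.base.c ((G.toE2.m₁ : ℤ) * ccr.cc.A)
      ((G.toE2.m₁ : ℤ) ^ 2 * ccr.cc.B) ccr.cc.Xt =
      MonicCubic.mulCoords G.toE2.fe.base.a G.toE2.fe.base.b G.toE2.fe.base.c (smulCoords (G.toE2.m₁ : ℤ) ccr.cc.XD)
        (prodPowCoords G.toE2.fe.base.a G.toE2.fe.base.b G.toE2.fe.base.c [])) &&
    twoViewCheck G.toE2.fe.base.a G.toE2.fe.base.b G.toE2.fe.base.c G.toE2.fe.u G.toE2.fe.d G.toE2.m₁ G.toE2.m₂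
      ccr.cc.Xt ccr.cc.Yt &&
    twoViewCheck G.toE2.fe.base.a G.toE2.fe.base.b G.toE2.fe.base.c G.toE2.fe.u G.toE2.fe.d G.toE2.m₁ G.toE2.m₂
      ccr.cc.XD ccr.cc.YD &&
    decide (0 < MonicCubic.disc ccr.cc.A ccr.cc.B ccr.cc.C) &&
    decide (normFormZ G.toE2.fe.base.a G.toE2.fe.base.b G.toE2.fe.base.c ccr.cc.XD.1 ccr.cc.XD.2.1 ccr.cc.XD.2.2 ≠ 0) &&
    decide ((normFormZ G.toE2.fe.base.a G.toE2.fe.base.b G.toE2.fe.base.c ccr.cc.XD.1 ccr.cc.XD.2.1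
      ccr.cc.XD.2.2).natAbs = (ccr.cc.dn.map fun pe => pe.1 ^ pe.2).prod) &&
    (ccr.cc.dn.all fun pe => primeDispatch G.toE2 ccr.cc ccr.cc.XD ccr.cc.YD ccr.cc.dinvA ccr.cc.dinvE pe.1) &&
    (ccr.cc.codes.all fun bc => codeClause G.toE2 ccr.cc bc) &&
    invCert G.toE2.fe.base.a G.toE2.fe.base.b G.toE2.fe.base.c G.toE2.fe.base.w₁ ccr.cc.XD ccr.cc.dW1 &&
    invCert G.toE2.fe.base.a G.toE2.fe.base.b G.toE2.fe.base.c G.toE2.fe.base.w₂ ccr.cc.XD ccr.cc.dW2 &&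
    (ccr.cc.Q.all fun q => decide (0 < q)) &&
    decide (ccr.cc.head.length = 5) &&
    ((fam2 ccr.cc).all fun f => famCheckE2R G ccr f) &&
    (linLtCond (G.fre.re.I ccr.o₀).1 (G.fre.re.I ccr.o₀).2 (G.fre.re.I ccr.o₁).1 (G.fre.re.I ccr.o₁).2 ccr.cc.Xt &&
      linLtCond (G.fre.re.I ccr.o₁).1 (G.fre.re.I ccr.o₁).2 (G.fre.re.I ccr.o₂).1 (G.fre.re.I ccr.o₂).2 ccr.cc.Xt) &&
    decide (∀ T : Finset (Fin (fam2 ccr.cc).length), T ≠ ∅ →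
      ∃ k : Fin (G.toE2.fe.base.chars.length + 5), Odd (T.filter fun j => bitR2 G ccr k j = true).card) &&
    (ks.all fun k => k.lite G.toE2 ccr.cc) &&
    decide (((Finset.univ ×ˢ Finset.univ).filter
      (fun p : Finset (Fin 0) × Finset (Fin (fam2 ccr.cc).length) => admR2K G ccr ks p.1 p.2 = true)).card <
        2 ^ (r + 1))

end Checkers

end Summit.BirchSwinnertonDyer.BirchSwinnertonDyer.Rank2Observatory.TwoDescCl

end
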